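import Literature.AlgebraicGeometry.HodgeTheory.BettiHodgeConjectureProductsIsolatedHomWindowCriterion
import HarnessLib

/-!
# `HC` for the powers `X^{m+1}` of a smooth projective `n`-fold: `HC(X^{m+2})` ⟺ `HC(X^{m+1})` and the window criterion for `X × X^{m+1}` (pieces `Hⁱ(X) ⊗ Hʲ(X^{m+1})`, `1 ≤ i ≤ n`,
# `1 ≤ j ≤ n(m+1)`, `i + j = 2c ≥ 4` — per piece, and per morphism of Hodge structures `φ : H^{2n(m+1)−j}(X^{m+1}) → Hⁱ(X)(c − n(m+1))`); hence `HC` of ALL powers ⟺ `HC(X)` and all the window criteria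
# (Voisin I §11.3.3 Thm. 11.38–11.40, Lemma 11.41, pp. 285–287; §7.3.2 Lemma 7.28; Thm. 11.30; Voisin II Prop. 9.20; Arapura Lemma 4.2, Cor. 1.2; Voisin 2025 §3.2.1)

Family `hodge`, lane `lit-hodgefound` (Track 2 foundations library; Layers A1/A4), layer `Literature/AlgebraicGeometry/HodgeTheory`.  THEOREMS ONLY (no definition, no named fact, no instance;
D-0026 net debt `0`).  The tree's explicit powers are `powObj X (m + 1) = X ⊗ powObj X m` (`powObj X 0 = X`, dimension `n(m+1)`, `isSmoothProjective_powObj`), and `HC(X^{m+1}) ⟹ HC(X)`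
(`hodgeConjectureFor_of_powObj`: a projection is surjective), `HC(X × W) ⟹ HC(X), HC(W)` (`hodgeConjectureFor_of_tensor_left/right`).  Feeding the seat's isolated window criterion (g31-#11:
given `HC(Y)`, `HC(Z)`, `HC(Y × Z)` ⟺ `crossMap t ⊗ 1` algebraic for the Hodge classes `t` of the window pieces ⟺ every window Hodge morphism is induced by such a `crossMap t`) with `Y = X`,
`Z = X^{m+1}` gives the INDUCTIVE STEP `HC(X^{m+2}) ⟺ HC(X^{m+1}) ∧ window(X, X^{m+1})` (§1 per piece, §2 per Hodge morphism), and by induction on `m`: `HC(X^{m+1})` for all `m` ⟺ `HC(X)` and the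
window criteria for all `m` (§3).

WHAT IS PROVED.
* §1 **`BettiUniverse.hodgeConjectureFor_powObj_succ_iff_forall_kunneth_pieces_window_algebraic`** — `HC(X^{m+2})` ⟺ `HC(X^{m+1})` ∧ for all `2 ≤ c`, `1 ≤ i ≤ n`, `1 ≤ j ≤ n(m+1)`, `i + j = 2c`
  and all Hodge classes `t` of `Hⁱ(X) ⊗ Hʲ(X^{m+1})`, `crossMap t ⊗ 1` is algebraic on `X × X^{m+1} = X^{m+2}`.
* §2 (complex orientations) **`BettiUniverse.hodgeConjectureFor_powObj_succ_iff_forall_hom_window_exists_crossMap_algebraic`** — the same with the window stated on morphisms of Hodge structures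
  `φ : Hᵃ(X^{m+1}) → Hⁱ(X)(r)`, `a + j = 2n(m+1)`, `n(m+1) + r = c`.
* §3 **`BettiUniverse.forall_hodgeConjectureFor_powObj_iff`** — (`∀ m, HC(X^{m+1})`) ⟺ `HC(X)` ∧ `∀ m`, the per-piece window criterion for `X × X^{m+1}`.

THE PRINTS.  C. Voisin (2002) [VoisinHodgeI2002] §7.3.2 Lemma 7.28, Rem. 7.29; §11.3.1 Thm. 11.30; §11.3.3 Thm. 11.38–11.40, Lemma 11.41 and pp. 285–287; §6.2.3 Thm. 6.25.  C. Voisin (2003) [VoisinHodgeII2003]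
§9.2.4 Prop. 9.20.  D. Arapura (2006) [Arapura2006] §4 Lemma 4.2, §1 Cor. 1.2.  C. Voisin (2025) [Voisin2025] §3.2.1 (12)–(14), Prop. 3.8, Cor. 3.9.  P. Deligne (2000/2006) [Deligne2000] §1.

THE OBJECTS (all the tree's).  `powObj`, `powObj_succ`, `powObj_zero`, `isSmoothProjective_powObj`, `hodgeConjectureFor_of_powObj`, `hodgeConjectureFor_of_tensor_left/right`, `BettiUniverse.kunnethSummand`,
`BettiUniverse.crossMap`, `BettiUniverse.hodge`, `corrAction complexOrientationFamily`, `HodgeStructure.Hom`, `tateTwist`, `cast`, `hodgeClasses`, `ofRatClass`, `algebraicClasses`, `HodgeConjectureFor`;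
the seat's g31-#11 `BettiUniverse.hodgeConjectureFor_tensor_iff_forall_kunneth_pieces_window_algebraic`, `BettiUniverse.hodgeConjectureFor_tensor_iff_forall_hom_window_exists_crossMap_algebraic`.

DEVIATIONS / SCOPE.  The tree's explicit powers `powObj`; complex orientations in §2.  No definitions.

## References
* [VoisinHodgeI2002] C. Voisin, *Hodge Theory and Complex Algebraic Geometry I* (2002) — §6.2.3 Thm. 6.25; §7.3.2 Lemma 7.28, Rem. 7.29; §11.3.1 Thm. 11.30; §11.3.3 Thm. 11.38–11.40, Lemma 11.41, pp. 285–287.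
* [VoisinHodgeII2003] C. Voisin, *Hodge Theory and Complex Algebraic Geometry II* (2003) — §9.2.4 Prop. 9.20.
* [Arapura2006] D. Arapura, *Motivation for Hodge cycles* (2006) — §4 Lemma 4.2, §1 Cor. 1.2.
* [Voisin2025] C. Voisin, *Cycle classes on algebraic varieties* (2025) — §3.2.1 (12)–(14), Prop. 3.8, Cor. 3.9.
* [Deligne2000] P. Deligne, *The Hodge conjecture* (Clay problem description) — §1.

## Provenance
Lane `lit-hodgefound` (Hodge path, Track 2), prover seat `lit-hodgefound-p29` (generation 31), self-proposed row g31-#13 (the window criteria for the powers of a variety; induction on the exponent).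
-/

noncomputable section

open scoped TensorProduct
open CategoryTheory MonoidalCategory CartesianMonoidalCategory Module Finset
open Literature.AlgebraicTopology.SingularHomology
open Literature.Geometry.Kaehler

namespace Literature.AlgebraicGeometry.HodgeTheory

open Literature.AlgebraicGeometry.Motives
open Literature.AlgebraicGeometry.Motives.HodgeStructure

variable {n : ℕ} {X : SchemeOver ℂ}

variable [HodgeTensorFacts.{0, 0}]

/-! ### §1 The inductive step, per Künneth piece -/

/-- **`HC(X^{m+2})` ⟺ `HC(X^{m+1})` and the window criterion for `X × X^{m+1}`, per piece**: for all `2 ≤ c`, `1 ≤ i ≤ n`, `1 ≤ j ≤ n(m+1)`, `i + j = 2c` and every Hodge class `t` of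
`Hⁱ(X) ⊗ Hʲ(X^{m+1}) ⊂ H^{2c}(X^{m+2})`, `crossMap t ⊗ 1` is algebraic (`X^{m+2} = X × X^{m+1}`; `HC` of a product gives `HC` of the factors, and g31-#11 §1). [cite: VoisinHodgeI2002, §7.3.2 Lemma 7.28, §11.3.3 Thm. 11.38–11.40, Lemma 11.41 and p. 287, §11.3.1 Thm. 11.30]
[cite: Arapura2006, §4 Lemma 4.2 and §1 Cor. 1.2] [cite: VoisinHodgeII2003, §9.2.4 Prop. 9.20] [cite: Deligne2000, §1] -/
theorem BettiUniverse.hodgeConjectureFor_powObj_succ_iff_forall_kunneth_pieces_window_algebraic (hHD : exists_isReal_hodgeModel) (hX : IsSmoothProjective n X) (m : ℕ) :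
    HodgeConjectureFor (n * (m + 2)) (powObj X (m + 1)) ↔
      HodgeConjectureFor (n * (m + 1)) (powObj X m) ∧
        ∀ (c i j : ℕ) (hij : i + j = 2 * c), 1 ≤ i → i ≤ n → 1 ≤ j → j ≤ n * (m + 1) → 2 ≤ c →
          ∀ t ∈ (BettiUniverse.kunnethSummand hHD hX (isSmoothProjective_powObj hX m) (2 * c) ⟨(i, j), HasAntidiagonal.mem_antidiagonal.2 hij⟩).hodgeClasses c,
            ofRatClass (ComplexPoints (X ⊗ powObj X m)) (2 * c) (BettiUniverse.crossMap X (powObj X m) hij t) ∈ algebraicClasses (X ⊗ powObj X m) c := by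
  have hXm := isSmoothProjective_powObj hX m
  have hXm1 : IsSmoothProjective (n * (m + 2)) (X ⊗ powObj X m) := by
    have h := isSmoothProjective_powObj hX (m + 1)
    rwa [powObj_succ] at h
  rw [powObj_succ]
  refine ⟨fun h ↦ ?_, fun h ↦ ?_⟩
  · have h' : HodgeConjectureFor (n + n * (m + 1)) (X ⊗ powObj X m) := by
      rw [show n + n * (m + 1) = n * (m + 2) by ring]
      exact h
    have hHCXm : HodgeConjectureFor (n * (m + 1)) (powObj X m) := hodgeConjectureFor_of_tensor_right hX hXm h'
    have hHCX : HodgeConjectureFor n X := hodgeConjectureFor_of_tensor_left hX hXm h'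
    exact ⟨hHCXm, (BettiUniverse.hodgeConjectureFor_tensor_iff_forall_kunneth_pieces_window_algebraic hHD hX hXm hXm1 hHCX hHCXm).1 h⟩
  · have hHCX : HodgeConjectureFor n X := hodgeConjectureFor_of_powObj hX m h.1
    exact (BettiUniverse.hodgeConjectureFor_tensor_iff_forall_kunneth_pieces_window_algebraic hHD hX hXm hXm1 hHCX h.1).2 h.2

/-! ### §2 The inductive step, per morphism of Hodge structures -/

/-- **`HC(X^{m+2})` ⟺ `HC(X^{m+1})` and the window criterion for `X × X^{m+1}` on morphisms of Hodge structures** (complex orientations): for `2 ≤ c`, `1 ≤ i ≤ n`, `1 ≤ j ≤ n(m+1)`, `i + j = 2c`,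
`a + j = 2n(m+1)`, `n(m+1) + r = c`, every morphism of `ℚ`-Hodge structures `φ : Hᵃ(X^{m+1}) → Hⁱ(X)(r)` is induced on `Hᵃ(X^{m+1};ℂ)` by some `crossMap t`, `t ∈ Hⁱ(X;ℚ) ⊗ Hʲ(X^{m+1};ℚ)`, with
`crossMap t ⊗ 1` algebraic (g31-#11 §2, Lemma 11.41 with integer twists). [cite: VoisinHodgeI2002, §7.3.1 Def. 7.22, §7.3.2 Lemma 7.28, §11.3.3 Thm. 11.38–11.40, Lemma 11.41 and pp. 285–287, §11.3.1 Thm. 11.30]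
[cite: Arapura2006, §4 Lemma 4.2 and §1 Cor. 1.2] [cite: Voisin2025, §3.2.1 (12)–(14), Prop. 3.8 and Cor. 3.9] [cite: Deligne2000, §1] -/
theorem BettiUniverse.hodgeConjectureFor_powObj_succ_iff_forall_hom_window_exists_crossMap_algebraic (hHD : exists_isReal_hodgeModel) (hX : IsSmoothProjective n X) (m : ℕ) :
    HodgeConjectureFor (n * (m + 2)) (powObj X (m + 1)) ↔
      HodgeConjectureFor (n * (m + 1)) (powObj X m) ∧
        ∀ (c i j a : ℕ) (r : ℤ) (_hc : 2 ≤ c) (_hi : 1 ≤ i) (_hin : i ≤ n) (_hj : 1 ≤ j) (_hjn : j ≤ n * (m + 1)) (hij : i + j = 2 * c) (_haj : a + j = 2 * (n * (m + 1)))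
          (hab : a + 2 * c = i + 2 * (n * (m + 1))) (_hr : ((n * (m + 1) : ℕ) : ℤ) + r = ((c : ℕ) : ℤ)) (hw : ((i : ℕ) : ℤ) - 2 * r = ((a : ℕ) : ℤ))
          (φ : HodgeStructure.Hom (BettiUniverse.hodge hHD (isSmoothProjective_powObj hX m) a) (((BettiUniverse.hodge hHD hX i).tateTwist r).cast hw)),
          ∃ t : bettiCohomology X i ⊗[ℚ] bettiCohomology (powObj X m) j,
            ofRatClass (ComplexPoints (X ⊗ powObj X m)) (2 * c) (BettiUniverse.crossMap X (powObj X m) hij t) ∈ algebraicClasses (X ⊗ powObj X m) c ∧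
              ∀ v, corrAction complexOrientationFamily hX (isSmoothProjective_powObj hX m) hab (ofRatClass (ComplexPoints (X ⊗ powObj X m)) (2 * c) (BettiUniverse.crossMap X (powObj X m) hij t))
                  (ofRatClass (ComplexPoints (powObj X m)) a v) = ofRatClass (ComplexPoints X) i (φ.toLinearMap v) := by
  have hXm := isSmoothProjective_powObj hX m
  have hXm1 : IsSmoothProjective (n * (m + 2)) (X ⊗ powObj X m) := by
    have h := isSmoothProjective_powObj hX (m + 1)
    rwa [powObj_succ] at h
  rw [powObj_succ]
  refine ⟨fun h ↦ ?_, fun h ↦ ?_⟩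
  · have h' : HodgeConjectureFor (n + n * (m + 1)) (X ⊗ powObj X m) := by
      rw [show n + n * (m + 1) = n * (m + 2) by ring]
      exact h
    have hHCXm : HodgeConjectureFor (n * (m + 1)) (powObj X m) := hodgeConjectureFor_of_tensor_right hX hXm h'
    have hHCX : HodgeConjectureFor n X := hodgeConjectureFor_of_tensor_left hX hXm h'
    exact ⟨hHCXm, (BettiUniverse.hodgeConjectureFor_tensor_iff_forall_hom_window_exists_crossMap_algebraic hHD hX hXm hXm1 hHCX hHCXm).1 h⟩
  · have hHCX : HodgeConjectureFor n X := hodgeConjectureFor_of_powObj hX m h.1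
    exact (BettiUniverse.hodgeConjectureFor_tensor_iff_forall_hom_window_exists_crossMap_algebraic hHD hX hXm hXm1 hHCX h.1).2 h.2

/-! ### §3 All the powers -/

/-- **`HC(X^{m+1})` for every `m` ⟺ `HC(X)` and, for every `m`, the per-piece window criterion for `X × X^{m+1}`** (induction on `m` with §1; `X^1 = X`). [cite: VoisinHodgeI2002, §7.3.2 Lemma 7.28, §11.3.3 Thm. 11.38–11.40, Lemma 11.41 and p. 287, §11.3.1 Thm. 11.30]
[cite: Arapura2006, §4 Lemma 4.2 and §1 Cor. 1.2] [cite: VoisinHodgeII2003, §9.2.4 Prop. 9.20] [cite: Deligne2000, §1] -/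
theorem BettiUniverse.forall_hodgeConjectureFor_powObj_iff (hHD : exists_isReal_hodgeModel) (hX : IsSmoothProjective n X) :
    (∀ m : ℕ, HodgeConjectureFor (n * (m + 1)) (powObj X m)) ↔
      HodgeConjectureFor n X ∧
        ∀ (m c i j : ℕ) (hij : i + j = 2 * c), 1 ≤ i → i ≤ n → 1 ≤ j → j ≤ n * (m + 1) → 2 ≤ c →
          ∀ t ∈ (BettiUniverse.kunnethSummand hHD hX (isSmoothProjective_powObj hX m) (2 * c) ⟨(i, j), HasAntidiagonal.mem_antidiagonal.2 hij⟩).hodgeClasses c,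
            ofRatClass (ComplexPoints (X ⊗ powObj X m)) (2 * c) (BettiUniverse.crossMap X (powObj X m) hij t) ∈ algebraicClasses (X ⊗ powObj X m) c := by
  refine ⟨fun h ↦ ⟨?_, fun m ↦ ((BettiUniverse.hodgeConjectureFor_powObj_succ_iff_forall_kunneth_pieces_window_algebraic hHD hX m).1 (h (m + 1))).2⟩, fun h m ↦ ?_⟩
  · have h0 := h 0
    rwa [Nat.zero_add, Nat.mul_one, powObj_zero] at h0
  · induction m with
    | zero =>
      rw [Nat.zero_add, Nat.mul_one, powObj_zero]
      exact h.1
    | succ m ih => exact (BettiUniverse.hodgeConjectureFor_powObj_succ_iff_forall_kunneth_pieces_window_algebraic hHD hX m).2 ⟨ih, h.2 m⟩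

end Literature.AlgebraicGeometry.HodgeTheory

end
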